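import Summits.Ventures.CertifiedManyBodySolver.Downfold.S2SeamEmery
import Summits.Ventures.CertifiedManyBodySolver.Downfold.BoxesLa214
import HarnessLib

/-!
# Typed three-band (`3BE`) boxes of record at the S2 seam: `emeryBoxLa214` (La₂CuO₄, x = 0) and
# `emeryBoxHg1201` (HgBa₂CuO₄, P = 0) — the two boxes an S2 Emery producer can bind TODAY

Venture CertifiedManyBodySolver, cell `pub/hubbard-downfold` (stage S1 = ROUTER), seat hubbard-downfold-mod-4;
namespace `Summit.Ventures.CertifiedManyBodySolver.Downfold`. Sequel of `Downfold.S2SeamEmery` (the 3BE seam: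
`emeryLineCoords`, `emeryLo/emeryHi`, doors `holdsOn_of_forall_emeryLineBox`, `holdsOn_emeryEnergyFloor`,
`abs_emeryEnergyDensity_sub_le_of_mem_emeryLineBox`) and of mod-1's `BoxesLa214` (`Entry.ofEnds`). It types VERBATIM
the «THREE-BAND (3BE) COMPANION BOX» rows of the two boxes of record whose five seam entries (`t_pd, t_pp,
Delta_pd, U_dd, U_pp`) are all LOCATED (`router/EMERY-LINE-ROWS.tsv` v1.1, column `S2_bindable_p488217 = yes`):

* `emeryBoxLa214` — La₂CuO₄, column M13 (x = 0, P = 0): Δ_pd [1.7, 4.0], t_pd [1.29, 1.52], t_pp [0.46, 0.66],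
  |t_pp′| [0.12, 0.15], U_dd [7.0, 10.5], U_pp [3.4, 4.64], V_pd [0.57, 1.88] eV, n_holes = 1;
* `emeryBoxHg1201` — HgBa₂CuO₄, M19, P = 0: Δ_pd [1.4, 2.5], t_pd [1.12, 1.32], t_pp [0.64, 0.85], t_pp′ [0.161, 0.208],
  U_dd [8.0, 9.9], U_pp [4.7, 5.9], V_pd [1.8, 2.2] eV, n_holes [1.125, 1.16];

and for each: `…_mem_iff` (membership unfolded), `…_emeryLo / …_emeryHi` (the delivered six-box corners at reference level
`εp = 0`, as numerals in S2's order `(t_pd, t_pp, ε_d, ε_p, U_d, U_p)`), `…_energyFloor` (a floor certified at the 64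
vertices of that numeric six-box is a box word — the hypothesis an S2 producer discharges), `…_energyWord` (any
∀-statement on the numeric six-box is a box word), `…_widthBudget` (the Lipschitz energy price of the box width,
`14.02` resp. `9.78` per site, as an exact rational), `…_cellFilling` (ρ enclosure) and a NON-VACUITY witness `…_witness_mem`.

Everything here is PROVED (definitions with bodies; no `sorry`, no named fact). HONEST FRAMING: these are S1's SYSTEMATIC
boxes — every entry is [float] literature or SCREENING-GRADE DFT exactly as the cited box row says (grade `.screening`);
typing certifies nothing about either material; Δ_pd is LEVEL-MIXED in both boxes (members tagged in the box files: bare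
Wannier levels vs solver-level / MACE values) and an S2 producer must print which member class it bound; the words below
inherit the hypotheses of whatever S2 statement is plugged in (energy words of the decorated model only); `t_pp′` and
`V_pd` have no direction in the decorated model of record and are carried as entries only. VERSION RULE: a later box
addendum that moves an edge gets a NEW definition (append-only); these stay the boxes of the cited file versions
(La2CuO4-family.md §OF-RECORD v1.9 era companion l.181; HgBa2CuO4.md companion l.134 / rows l.27–33).
-/

namespace Summit.Ventures.CertifiedManyBodySolver.Downfold

open NonemptyInterval Literature.MathematicalPhysics.QuantumLattice

/-! ### `emeryBoxLa214` — La₂CuO₄ (box #18 La2CuO4-family.md, column M13, x = 0, P = 0) -/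

/-- `DeltaPd`: [1.7, 4.0] eV — LEVEL-MIXED, tagged: DFT-level {p/w3b 1.74–1.92, c 2.80–2.91, Weber2012 2.61} vs solver-level {3.24 Kung2016, 3.6 cLDA HSC89, 3.7 cGW-SIC}. Source: router/BOXES/La2CuO4-family.md l.181 «THREE-BAND (3BE) COMPANION BOX» (+ §LIT-PREVIEW l.30–35, §DFT-3b l.116–117); router/EMERY-LINE-ROWS.tsv row 1. [folklore] -/
def la214Emery_Delta : Entry := Entry.ofEnds (17/10) (4) (by norm_num) .screening
/-- `tpd`: [1.29, 1.52] eV (WAN c/p/w3b ⊕ FLOOR 8 %; LIT 1.3 / 1.39 / 1.13 inside). Source: router/BOXES/La2CuO4-family.md l.181 «THREE-BAND (3BE) COMPANION BOX» (+ §LIT-PREVIEW l.30–35, §DFT-3b l.116–117); router/EMERY-LINE-ROWS.tsv row 1. [folklore] -/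
def la214Emery_tpd : Entry := Entry.ofEnds (129/100) (38/25) (by norm_num) .screening
/-- `tpp`: [0.46, 0.66] eV. Source: router/BOXES/La2CuO4-family.md l.181 «THREE-BAND (3BE) COMPANION BOX» (+ §LIT-PREVIEW l.30–35, §DFT-3b l.116–117); router/EMERY-LINE-ROWS.tsv row 1. [folklore] -/
def la214Emery_tpp : Entry := Entry.ofEnds (23/50) (33/50) (by norm_num) .screening
/-- `tppP`: |t_pp′| ∈ [0.12, 0.15] eV (DFT-own; sign per set). Source: router/BOXES/La2CuO4-family.md l.181 «THREE-BAND (3BE) COMPANION BOX» (+ §LIT-PREVIEW l.30–35, §DFT-3b l.116–117); router/EMERY-LINE-ROWS.tsv row 1. [folklore] -/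
def la214Emery_tppP : Entry := Entry.ofEnds (3/25) (3/20) (by norm_num) .screening
/-- `Udd`: [7.0, 10.5] eV (cLDA 10.5 HSC89 ∪ static cRPA@LDA dp 7.00 Werner2015 ∪ practice 8.4/8.5/9.5). Source: router/BOXES/La2CuO4-family.md l.181 «THREE-BAND (3BE) COMPANION BOX» (+ §LIT-PREVIEW l.30–35, §DFT-3b l.116–117); router/EMERY-LINE-ROWS.tsv row 1. [folklore] -/
def la214Emery_Udd : Entry := Entry.ofEnds (7) (21/2) (by norm_num) .screening
/-- `Upp`: [3.4, 4.64] eV (cLDA 4.0, Kung 4.1, cRPA 4.64, derived 3.4–4.2). Source: router/BOXES/La2CuO4-family.md l.181 «THREE-BAND (3BE) COMPANION BOX» (+ §LIT-PREVIEW l.30–35, §DFT-3b l.116–117); router/EMERY-LINE-ROWS.tsv row 1. [folklore] -/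
def la214Emery_Upp : Entry := Entry.ofEnds (17/5) (116/25) (by norm_num) .screening
/-- `Vpd`: [0.57, 1.88] eV (cLDA 1.2, cRPA 1.88, derived 0.57–0.75). Source: router/BOXES/La2CuO4-family.md l.181 «THREE-BAND (3BE) COMPANION BOX» (+ §LIT-PREVIEW l.30–35, §DFT-3b l.116–117); router/EMERY-LINE-ROWS.tsv row 1. [folklore] -/
def la214Emery_Vpd : Entry := Entry.ofEnds (57/100) (47/25) (by norm_num) .screening
/-- `nHoles`: n_holes = 1 (x = 0; the LSCO columns M14–M17/M50/M53/M54 carry 1 + x with the box n-row widths — NOT this box). Source: router/BOXES/La2CuO4-family.md l.181 «THREE-BAND (3BE) COMPANION BOX» (+ §LIT-PREVIEW l.30–35, §DFT-3b l.116–117); router/EMERY-LINE-ROWS.tsv row 1. [folklore] -/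
def la214Emery_nH : Entry := Entry.ofEnds (1) (1) le_rfl .screening

/-- **The typed 3BE box of record `emeryBoxLa214`** (La₂CuO₄ (box #18 La2CuO4-family.md, column M13, x = 0, P = 0)); every `EmeryCoord` carries an entry. [folklore] -/
def emeryBoxLa214 : EmeryBox := fun c =>
  match c with
  | .DeltaPd => some la214Emery_Delta
  | .tpd => some la214Emery_tpd
  | .tpp => some la214Emery_tpp
  | .tppP => some la214Emery_tppP
  | .Udd => some la214Emery_Udd
  | .Upp => some la214Emery_Upp
  | .Vpd => some la214Emery_Vpd
  | .nHoles => some la214Emery_nH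

/-- **Membership in `emeryBoxLa214` unfolded** (to APPLY a `HoldsOn` word at a parameter vector, discharge these inequalities). [folklore] -/
theorem emeryBoxLa214_mem_iff (p : EmeryCoord → ℝ) :
    emeryBoxLa214.Mem p ↔
      (((17/10) : ℚ) : ℝ) ≤ p .DeltaPd ∧ p .DeltaPd ≤ (((4) : ℚ) : ℝ) ∧
      (((129/100) : ℚ) : ℝ) ≤ p .tpd ∧ p .tpd ≤ (((38/25) : ℚ) : ℝ) ∧
      (((23/50) : ℚ) : ℝ) ≤ p .tpp ∧ p .tpp ≤ (((33/50) : ℚ) : ℝ) ∧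
      (((3/25) : ℚ) : ℝ) ≤ p .tppP ∧ p .tppP ≤ (((3/20) : ℚ) : ℝ) ∧
      (((7) : ℚ) : ℝ) ≤ p .Udd ∧ p .Udd ≤ (((21/2) : ℚ) : ℝ) ∧
      (((17/5) : ℚ) : ℝ) ≤ p .Upp ∧ p .Upp ≤ (((116/25) : ℚ) : ℝ) ∧
      (((57/100) : ℚ) : ℝ) ≤ p .Vpd ∧ p .Vpd ≤ (((47/25) : ℚ) : ℝ) ∧
      (((1) : ℚ) : ℝ) ≤ p .nHoles ∧ p .nHoles ≤ (((1) : ℚ) : ℝ) := by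
  constructor
  · intro h
    have h0 := (Entry.mem_ofEnds_iff _ _ _ _ _).1 (h .DeltaPd la214Emery_Delta rfl)
    have h1 := (Entry.mem_ofEnds_iff _ _ _ _ _).1 (h .tpd la214Emery_tpd rfl)
    have h2 := (Entry.mem_ofEnds_iff _ _ _ _ _).1 (h .tpp la214Emery_tpp rfl)
    have h3 := (Entry.mem_ofEnds_iff _ _ _ _ _).1 (h .tppP la214Emery_tppP rfl)
    have h4 := (Entry.mem_ofEnds_iff _ _ _ _ _).1 (h .Udd la214Emery_Udd rfl)
    have h5 := (Entry.mem_ofEnds_iff _ _ _ _ _).1 (h .Upp la214Emery_Upp rfl)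
    have h6 := (Entry.mem_ofEnds_iff _ _ _ _ _).1 (h .Vpd la214Emery_Vpd rfl)
    have h7 := (Entry.mem_ofEnds_iff _ _ _ _ _).1 (h .nHoles la214Emery_nH rfl)
    exact ⟨h0.1, h0.2, h1.1, h1.2, h2.1, h2.2, h3.1, h3.2, h4.1, h4.2, h5.1, h5.2, h6.1, h6.2, h7.1, h7.2⟩
  · rintro ⟨a0, b0, a1, b1, a2, b2, a3, b3, a4, b4, a5, b5, a6, b6, a7, b7⟩ i e hi
    cases i <;> simp only [emeryBoxLa214, Option.some.injEq] at hi <;> subst hi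
    · exact (Entry.mem_ofEnds_iff _ _ _ _ _).2 ⟨a0, b0⟩
    · exact (Entry.mem_ofEnds_iff _ _ _ _ _).2 ⟨a1, b1⟩
    · exact (Entry.mem_ofEnds_iff _ _ _ _ _).2 ⟨a2, b2⟩
    · exact (Entry.mem_ofEnds_iff _ _ _ _ _).2 ⟨a3, b3⟩
    · exact (Entry.mem_ofEnds_iff _ _ _ _ _).2 ⟨a4, b4⟩
    · exact (Entry.mem_ofEnds_iff _ _ _ _ _).2 ⟨a5, b5⟩
    · exact (Entry.mem_ofEnds_iff _ _ _ _ _).2 ⟨a6, b6⟩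
    · exact (Entry.mem_ofEnds_iff _ _ _ _ _).2 ⟨a7, b7⟩

/-- Lower corner of the delivered six-box of `emeryBoxLa214` at `εp = 0`, order `(t_pd, t_pp, ε_d, ε_p, U_d, U_p)`: `(129/100, 23/50, 17/10, 0, 7, 17/5)`. [folklore] -/
theorem la214_emeryLo : emeryLo 0 la214Emery_tpd la214Emery_tpp la214Emery_Delta la214Emery_Udd la214Emery_Upp = ![129/100, 23/50, 17/10, 0, 7, 17/5] := by
  ext i; fin_cases i <;> simp [emeryLo, la214Emery_tpd, la214Emery_tpp, la214Emery_Delta, la214Emery_Udd, la214Emery_Upp]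

/-- Upper corner of the delivered six-box of `emeryBoxLa214` at `εp = 0`: `(38/25, 33/50, 4, 0, 21/2, 116/25)`. [folklore] -/
theorem la214_emeryHi : emeryHi 0 la214Emery_tpd la214Emery_tpp la214Emery_Delta la214Emery_Udd la214Emery_Upp = ![38/25, 33/50, 4, 0, 21/2, 116/25] := by
  ext i; fin_cases i <;> simp [emeryHi, la214Emery_tpd, la214Emery_tpp, la214Emery_Delta, la214Emery_Udd, la214Emery_Upp]

/-- **S2 box statement ⇒ box word on `emeryBoxLa214`**: any statement `∀ q ∈ Set.Icc ![129/100, 23/50, 17/10, 0, 7, 17/5] ![38/25, 33/50, 4, 0, 21/2, 116/25], W q` about the numeric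
six-box (reference level `εp = 0`) holds on the box as `p ↦ W (emeryLineCoords 0 p)`. [folklore] -/
theorem emeryBoxLa214_energyWord {W : (Fin 6 → ℝ) → Prop}
    (hW : ∀ q ∈ Set.Icc (![129/100, 23/50, 17/10, 0, 7, 17/5] : Fin 6 → ℝ) ![38/25, 33/50, 4, 0, 21/2, 116/25], W q) :
    HoldsOn (fun p : EmeryCoord → ℝ => W (emeryLineCoords 0 p)) emeryBoxLa214 := by
  have h := holdsOn_of_forall_emeryLineBox (E := emeryBoxLa214) (εp := 0) (eA := la214Emery_tpd) (eB := la214Emery_tpp)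
    (eD := la214Emery_Delta) (eUd := la214Emery_Udd) (eUp := la214Emery_Upp) rfl rfl rfl rfl rfl (W := W)
    (by rw [la214_emeryLo, la214_emeryHi]; exact hW)
  simpa using h

/-- **Vertex-certified three-band energy floor on `emeryBoxLa214`**: if an S2 producer certifies `m ≤ e(emeryLine s v, ρ)` at the
`64` vertices `v` of the numeric six-box `[(129/100, 23/50, 17/10, 0, 7, 17/5), (38/25, 33/50, 4, 0, 21/2, 116/25)]`, the floor holds at every parameter vector of the box
(any O–O sign pattern `s`, any cell filling `ρ`). [cite: Israel1979, Thm. I.3.4] -/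
theorem emeryBoxLa214_energyFloor (s : Fin 4 → ℝ) (ρ : ℝ) {m : ℝ}
    (hm : ∀ v ∈ Fintype.piFinset (fun i => ({(![129/100, 23/50, 17/10, 0, 7, 17/5] : Fin 6 → ℝ) i, (![38/25, 33/50, 4, 0, 21/2, 116/25] : Fin 6 → ℝ) i} : Finset ℝ)),
      m ≤ emeryEnergyDensity (emeryLine s v) ρ) :
    HoldsOn (fun p : EmeryCoord → ℝ => m ≤ emeryEnergyDensity (emeryLine s (emeryLineCoords 0 p)) ρ) emeryBoxLa214 := by
  have h := holdsOn_emeryEnergyFloor (E := emeryBoxLa214) (εp := 0) (eA := la214Emery_tpd) (eB := la214Emery_tpp)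
    (eD := la214Emery_Delta) (eUd := la214Emery_Udd) (eUp := la214Emery_Upp) rfl rfl rfl rfl rfl s ρ (m := m)
    (by rw [la214_emeryLo, la214_emeryHi]; exact hm)
  simpa using h

/-- **The Lipschitz energy price of the width of `emeryBoxLa214`**: `8·w(t_pd) + 8·w(t_pp) + 2·w(Δ_pd) + w(U_dd) + 2·w(U_pp) = 14.02`
(eV per site; the a-priori class-constant bound of `abs_emeryEnergyDensity_sub_le_of_mem_emeryLineBox`). [folklore] -/
theorem la214_widthBudget :
    8 * la214Emery_tpd.widthR + 8 * la214Emery_tpp.widthR + 2 * la214Emery_Delta.widthR + la214Emery_Udd.widthR +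
        2 * la214Emery_Upp.widthR = ((701/50 : ℚ) : ℝ) := by
  simp only [Entry.widthR, la214Emery_tpd, la214Emery_tpp, la214Emery_Delta, la214Emery_Udd, la214Emery_Upp,
    Entry.encl_ofEnds_fst, Entry.encl_ofEnds_snd]
  push_cast; norm_num

/-- **Two parameter vectors of `emeryBoxLa214` differ in certified three-band energy density by at most `14.02`** (unit sign
pattern, common reference level, realised filling). [cite: Israel1979, Thm. I.3.4] -/
theorem emeryBoxLa214_energy_sub_le {ρ : ℝ} (hne : (emeryStates ρ).Nonempty) {s : Fin 4 → ℝ} (hs : ∀ i, |s i| ≤ 1)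
    (εp : ℝ) {p p' : EmeryCoord → ℝ} (hp : emeryBoxLa214.Mem p) (hp' : emeryBoxLa214.Mem p') :
    |emeryEnergyDensity (emeryLine s (emeryLineCoords εp p)) ρ -
        emeryEnergyDensity (emeryLine s (emeryLineCoords εp p')) ρ| ≤ ((701/50 : ℚ) : ℝ) := by
  rw [← la214_widthBudget]
  exact abs_emeryEnergyDensity_sub_le_of_mem_emeryLineBox (E := emeryBoxLa214) rfl rfl rfl rfl rfl hne hs εp hp hp'

/-- **Cell filling of `emeryBoxLa214`**: `ρ = (6 − n_holes)/4 ∈ [(6 − 1)/4, (6 − 1)/4]` for every member. [folklore] -/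
theorem emeryBoxLa214_cellFilling {p : EmeryCoord → ℝ} (hp : emeryBoxLa214.Mem p) :
    emeryCellFilling p ∈ Set.Icc ((((6 : ℚ) - 1) / 4 : ℚ) : ℝ) ((((6 : ℚ) - 1) / 4 : ℚ) : ℝ) := by
  have h := emeryCellFilling_mem_Icc (E := emeryBoxLa214) (eN := la214Emery_nH) rfl hp
  simpa [la214Emery_nH] using h

/-- **Non-vacuity witness**: the run-7 DFT «c» one-body set (Δ 2.911, t_pd 1.391, t_pp 0.660, t_pp′ 0.136) with Werner2015 three-band cRPA U_dd 7.00 / U_pp 4.64 / U_pd 1.88 at n_holes = 1 — a NON-VACUITY witness of the product box, not a recommended set (sets are tagged, never mixed, in the box file). [folklore] -/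
theorem emeryBoxLa214_witness_mem :
    emeryBoxLa214.Mem (fun c => match c with
      | .DeltaPd => (((2911/1000) : ℚ) : ℝ)
      | .tpd => (((1391/1000) : ℚ) : ℝ)
      | .tpp => (((33/50) : ℚ) : ℝ)
      | .tppP => (((17/125) : ℚ) : ℝ)
      | .Udd => (((7) : ℚ) : ℝ)
      | .Upp => (((116/25) : ℚ) : ℝ)
      | .Vpd => (((47/25) : ℚ) : ℝ)
      | .nHoles => (((1) : ℚ) : ℝ)
      ) := by
  rw [emeryBoxLa214_mem_iff]
  refine ⟨?_, ?_, ?_, ?_, ?_, ?_, ?_, ?_, ?_, ?_, ?_, ?_, ?_, ?_, ?_, ?_⟩ <;> exact_mod_cast (by norm_num)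

/-! ### `emeryBoxHg1201` — HgBa₂CuO₄ (box #1 HgBa2CuO4.md, M19, P = 0) -/

/-- `DeltaPd`: [1.4, 2.5] eV — LEVEL-MIXED, tagged: DFT-level {w3b 1.663, Weber2012 1.93} vs MACE {1.48 GW+LRFB, 2.17, 2.31, 2.42 cGW-SIC} (+1.0 eV p-level shift rule for MACE solvers). Source: router/BOXES/HgBa2CuO4.md l.134 «THREE-BAND (3BE) COMPANION BOX» (+ §LIT-PREVIEW l.27–33, §DFT-3b l.88–94); router/EMERY-LINE-ROWS.tsv row 2. [folklore] -/
def hg1201Emery_Delta : Entry := Entry.ofEnds (7/5) (5/2) (by norm_num) .screening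
/-- `tpd`: [1.12, 1.32] eV. Source: router/BOXES/HgBa2CuO4.md l.134 «THREE-BAND (3BE) COMPANION BOX» (+ §LIT-PREVIEW l.27–33, §DFT-3b l.88–94); router/EMERY-LINE-ROWS.tsv row 2. [folklore] -/
def hg1201Emery_tpd : Entry := Entry.ofEnds (28/25) (33/25) (by norm_num) .screening
/-- `tpp`: [0.64, 0.85] eV (row l.29; the companion prints 0.65). Source: router/BOXES/HgBa2CuO4.md l.134 «THREE-BAND (3BE) COMPANION BOX» (+ §LIT-PREVIEW l.27–33, §DFT-3b l.88–94); router/EMERY-LINE-ROWS.tsv row 2. [folklore] -/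
def hg1201Emery_tpp : Entry := Entry.ofEnds (16/25) (17/20) (by norm_num) .screening
/-- `tppP`: t_pp′ ∈ [0.161, 0.208] eV (Weber2012 0.161; WAN:j257148 0.208). Source: router/BOXES/HgBa2CuO4.md l.134 «THREE-BAND (3BE) COMPANION BOX» (+ §LIT-PREVIEW l.27–33, §DFT-3b l.88–94); router/EMERY-LINE-ROWS.tsv row 2. [folklore] -/
def hg1201Emery_tppP : Entry := Entry.ofEnds (161/1000) (26/125) (by norm_num) .screening
/-- `Udd`: [8.0, 9.9] eV (row l.30: MACE cGW-SIC 8.84 / +LRFB 8.99 ⊕ ±10 %; the companion prints 9.8). Source: router/BOXES/HgBa2CuO4.md l.134 «THREE-BAND (3BE) COMPANION BOX» (+ §LIT-PREVIEW l.27–33, §DFT-3b l.88–94); router/EMERY-LINE-ROWS.tsv row 2. [folklore] -/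
def hg1201Emery_Udd : Entry := Entry.ofEnds (8) (99/10) (by norm_num) .screening
/-- `Upp`: [4.7, 5.9] eV (row l.31: 5.31 ⊕ ±10 %, single source). Source: router/BOXES/HgBa2CuO4.md l.134 «THREE-BAND (3BE) COMPANION BOX» (+ §LIT-PREVIEW l.27–33, §DFT-3b l.88–94); router/EMERY-LINE-ROWS.tsv row 2. [folklore] -/
def hg1201Emery_Upp : Entry := Entry.ofEnds (47/10) (59/10) (by norm_num) .screening
/-- `Vpd`: [1.8, 2.2] eV (≈ 2 quoted ⊕ ±10 %, single source). Source: router/BOXES/HgBa2CuO4.md l.134 «THREE-BAND (3BE) COMPANION BOX» (+ §LIT-PREVIEW l.27–33, §DFT-3b l.88–94); router/EMERY-LINE-ROWS.tsv row 2. [folklore] -/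
def hg1201Emery_Vpd : Entry := Entry.ofEnds (9/5) (11/5) (by norm_num) .screening
/-- `nHoles`: n_holes = 1 + p ∈ [1.125, 1.16]. Source: router/BOXES/HgBa2CuO4.md l.134 «THREE-BAND (3BE) COMPANION BOX» (+ §LIT-PREVIEW l.27–33, §DFT-3b l.88–94); router/EMERY-LINE-ROWS.tsv row 2. [folklore] -/
def hg1201Emery_nH : Entry := Entry.ofEnds (9/8) (29/25) (by norm_num) .screening

/-- **The typed 3BE box of record `emeryBoxHg1201`** (HgBa₂CuO₄ (box #1 HgBa2CuO4.md, M19, P = 0)); every `EmeryCoord` carries an entry. [folklore] -/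
def emeryBoxHg1201 : EmeryBox := fun c =>
  match c with
  | .DeltaPd => some hg1201Emery_Delta
  | .tpd => some hg1201Emery_tpd
  | .tpp => some hg1201Emery_tpp
  | .tppP => some hg1201Emery_tppP
  | .Udd => some hg1201Emery_Udd
  | .Upp => some hg1201Emery_Upp
  | .Vpd => some hg1201Emery_Vpd
  | .nHoles => some hg1201Emery_nH

/-- **Membership in `emeryBoxHg1201` unfolded** (to APPLY a `HoldsOn` word at a parameter vector, discharge these inequalities). [folklore] -/
theorem emeryBoxHg1201_mem_iff (p : EmeryCoord → ℝ) :
    emeryBoxHg1201.Mem p ↔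
      (((7/5) : ℚ) : ℝ) ≤ p .DeltaPd ∧ p .DeltaPd ≤ (((5/2) : ℚ) : ℝ) ∧
      (((28/25) : ℚ) : ℝ) ≤ p .tpd ∧ p .tpd ≤ (((33/25) : ℚ) : ℝ) ∧
      (((16/25) : ℚ) : ℝ) ≤ p .tpp ∧ p .tpp ≤ (((17/20) : ℚ) : ℝ) ∧
      (((161/1000) : ℚ) : ℝ) ≤ p .tppP ∧ p .tppP ≤ (((26/125) : ℚ) : ℝ) ∧
      (((8) : ℚ) : ℝ) ≤ p .Udd ∧ p .Udd ≤ (((99/10) : ℚ) : ℝ) ∧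
      (((47/10) : ℚ) : ℝ) ≤ p .Upp ∧ p .Upp ≤ (((59/10) : ℚ) : ℝ) ∧
      (((9/5) : ℚ) : ℝ) ≤ p .Vpd ∧ p .Vpd ≤ (((11/5) : ℚ) : ℝ) ∧
      (((9/8) : ℚ) : ℝ) ≤ p .nHoles ∧ p .nHoles ≤ (((29/25) : ℚ) : ℝ) := by
  constructor
  · intro h
    have h0 := (Entry.mem_ofEnds_iff _ _ _ _ _).1 (h .DeltaPd hg1201Emery_Delta rfl)
    have h1 := (Entry.mem_ofEnds_iff _ _ _ _ _).1 (h .tpd hg1201Emery_tpd rfl)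
    have h2 := (Entry.mem_ofEnds_iff _ _ _ _ _).1 (h .tpp hg1201Emery_tpp rfl)
    have h3 := (Entry.mem_ofEnds_iff _ _ _ _ _).1 (h .tppP hg1201Emery_tppP rfl)
    have h4 := (Entry.mem_ofEnds_iff _ _ _ _ _).1 (h .Udd hg1201Emery_Udd rfl)
    have h5 := (Entry.mem_ofEnds_iff _ _ _ _ _).1 (h .Upp hg1201Emery_Upp rfl)
    have h6 := (Entry.mem_ofEnds_iff _ _ _ _ _).1 (h .Vpd hg1201Emery_Vpd rfl)
    have h7 := (Entry.mem_ofEnds_iff _ _ _ _ _).1 (h .nHoles hg1201Emery_nH rfl)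
    exact ⟨h0.1, h0.2, h1.1, h1.2, h2.1, h2.2, h3.1, h3.2, h4.1, h4.2, h5.1, h5.2, h6.1, h6.2, h7.1, h7.2⟩
  · rintro ⟨a0, b0, a1, b1, a2, b2, a3, b3, a4, b4, a5, b5, a6, b6, a7, b7⟩ i e hi
    cases i <;> simp only [emeryBoxHg1201, Option.some.injEq] at hi <;> subst hi
    · exact (Entry.mem_ofEnds_iff _ _ _ _ _).2 ⟨a0, b0⟩
    · exact (Entry.mem_ofEnds_iff _ _ _ _ _).2 ⟨a1, b1⟩
    · exact (Entry.mem_ofEnds_iff _ _ _ _ _).2 ⟨a2, b2⟩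
    · exact (Entry.mem_ofEnds_iff _ _ _ _ _).2 ⟨a3, b3⟩
    · exact (Entry.mem_ofEnds_iff _ _ _ _ _).2 ⟨a4, b4⟩
    · exact (Entry.mem_ofEnds_iff _ _ _ _ _).2 ⟨a5, b5⟩
    · exact (Entry.mem_ofEnds_iff _ _ _ _ _).2 ⟨a6, b6⟩
    · exact (Entry.mem_ofEnds_iff _ _ _ _ _).2 ⟨a7, b7⟩

/-- Lower corner of the delivered six-box of `emeryBoxHg1201` at `εp = 0`, order `(t_pd, t_pp, ε_d, ε_p, U_d, U_p)`: `(28/25, 16/25, 7/5, 0, 8, 47/10)`. [folklore] -/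
theorem hg1201_emeryLo : emeryLo 0 hg1201Emery_tpd hg1201Emery_tpp hg1201Emery_Delta hg1201Emery_Udd hg1201Emery_Upp = ![28/25, 16/25, 7/5, 0, 8, 47/10] := by
  ext i; fin_cases i <;> simp [emeryLo, hg1201Emery_tpd, hg1201Emery_tpp, hg1201Emery_Delta, hg1201Emery_Udd, hg1201Emery_Upp]

/-- Upper corner of the delivered six-box of `emeryBoxHg1201` at `εp = 0`: `(33/25, 17/20, 5/2, 0, 99/10, 59/10)`. [folklore] -/
theorem hg1201_emeryHi : emeryHi 0 hg1201Emery_tpd hg1201Emery_tpp hg1201Emery_Delta hg1201Emery_Udd hg1201Emery_Upp = ![33/25, 17/20, 5/2, 0, 99/10, 59/10] := by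
  ext i; fin_cases i <;> simp [emeryHi, hg1201Emery_tpd, hg1201Emery_tpp, hg1201Emery_Delta, hg1201Emery_Udd, hg1201Emery_Upp]

/-- **S2 box statement ⇒ box word on `emeryBoxHg1201`**: any statement `∀ q ∈ Set.Icc ![28/25, 16/25, 7/5, 0, 8, 47/10] ![33/25, 17/20, 5/2, 0, 99/10, 59/10], W q` about the numeric
six-box (reference level `εp = 0`) holds on the box as `p ↦ W (emeryLineCoords 0 p)`. [folklore] -/
theorem emeryBoxHg1201_energyWord {W : (Fin 6 → ℝ) → Prop}
    (hW : ∀ q ∈ Set.Icc (![28/25, 16/25, 7/5, 0, 8, 47/10] : Fin 6 → ℝ) ![33/25, 17/20, 5/2, 0, 99/10, 59/10], W q) :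
    HoldsOn (fun p : EmeryCoord → ℝ => W (emeryLineCoords 0 p)) emeryBoxHg1201 := by
  have h := holdsOn_of_forall_emeryLineBox (E := emeryBoxHg1201) (εp := 0) (eA := hg1201Emery_tpd) (eB := hg1201Emery_tpp)
    (eD := hg1201Emery_Delta) (eUd := hg1201Emery_Udd) (eUp := hg1201Emery_Upp) rfl rfl rfl rfl rfl (W := W)
    (by rw [hg1201_emeryLo, hg1201_emeryHi]; exact hW)
  simpa using h

/-- **Vertex-certified three-band energy floor on `emeryBoxHg1201`**: if an S2 producer certifies `m ≤ e(emeryLine s v, ρ)` at the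
`64` vertices `v` of the numeric six-box `[(28/25, 16/25, 7/5, 0, 8, 47/10), (33/25, 17/20, 5/2, 0, 99/10, 59/10)]`, the floor holds at every parameter vector of the box
(any O–O sign pattern `s`, any cell filling `ρ`). [cite: Israel1979, Thm. I.3.4] -/
theorem emeryBoxHg1201_energyFloor (s : Fin 4 → ℝ) (ρ : ℝ) {m : ℝ}
    (hm : ∀ v ∈ Fintype.piFinset (fun i => ({(![28/25, 16/25, 7/5, 0, 8, 47/10] : Fin 6 → ℝ) i, (![33/25, 17/20, 5/2, 0, 99/10, 59/10] : Fin 6 → ℝ) i} : Finset ℝ)),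
      m ≤ emeryEnergyDensity (emeryLine s v) ρ) :
    HoldsOn (fun p : EmeryCoord → ℝ => m ≤ emeryEnergyDensity (emeryLine s (emeryLineCoords 0 p)) ρ) emeryBoxHg1201 := by
  have h := holdsOn_emeryEnergyFloor (E := emeryBoxHg1201) (εp := 0) (eA := hg1201Emery_tpd) (eB := hg1201Emery_tpp)
    (eD := hg1201Emery_Delta) (eUd := hg1201Emery_Udd) (eUp := hg1201Emery_Upp) rfl rfl rfl rfl rfl s ρ (m := m)
    (by rw [hg1201_emeryLo, hg1201_emeryHi]; exact hm)
  simpa using h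

/-- **The Lipschitz energy price of the width of `emeryBoxHg1201`**: `8·w(t_pd) + 8·w(t_pp) + 2·w(Δ_pd) + w(U_dd) + 2·w(U_pp) = 9.78`
(eV per site; the a-priori class-constant bound of `abs_emeryEnergyDensity_sub_le_of_mem_emeryLineBox`). [folklore] -/
theorem hg1201_widthBudget :
    8 * hg1201Emery_tpd.widthR + 8 * hg1201Emery_tpp.widthR + 2 * hg1201Emery_Delta.widthR + hg1201Emery_Udd.widthR +
        2 * hg1201Emery_Upp.widthR = ((489/50 : ℚ) : ℝ) := by
  simp only [Entry.widthR, hg1201Emery_tpd, hg1201Emery_tpp, hg1201Emery_Delta, hg1201Emery_Udd, hg1201Emery_Upp,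
    Entry.encl_ofEnds_fst, Entry.encl_ofEnds_snd]
  push_cast; norm_num

/-- **Two parameter vectors of `emeryBoxHg1201` differ in certified three-band energy density by at most `9.78`** (unit sign
pattern, common reference level, realised filling). [cite: Israel1979, Thm. I.3.4] -/
theorem emeryBoxHg1201_energy_sub_le {ρ : ℝ} (hne : (emeryStates ρ).Nonempty) {s : Fin 4 → ℝ} (hs : ∀ i, |s i| ≤ 1)
    (εp : ℝ) {p p' : EmeryCoord → ℝ} (hp : emeryBoxHg1201.Mem p) (hp' : emeryBoxHg1201.Mem p') :
    |emeryEnergyDensity (emeryLine s (emeryLineCoords εp p)) ρ -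
        emeryEnergyDensity (emeryLine s (emeryLineCoords εp p')) ρ| ≤ ((489/50 : ℚ) : ℝ) := by
  rw [← hg1201_widthBudget]
  exact abs_emeryEnergyDensity_sub_le_of_mem_emeryLineBox (E := emeryBoxHg1201) rfl rfl rfl rfl rfl hne hs εp hp hp'

/-- **Cell filling of `emeryBoxHg1201`**: `ρ = (6 − n_holes)/4 ∈ [(6 − 29/25)/4, (6 − 9/8)/4]` for every member. [folklore] -/
theorem emeryBoxHg1201_cellFilling {p : EmeryCoord → ℝ} (hp : emeryBoxHg1201.Mem p) :
    emeryCellFilling p ∈ Set.Icc ((((6 : ℚ) - 29/25) / 4 : ℚ) : ℝ) ((((6 : ℚ) - 9/8) / 4 : ℚ) : ℝ) := by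
  have h := emeryCellFilling_mem_Icc (E := emeryBoxHg1201) (eN := hg1201Emery_nH) rfl hp
  simpa [hg1201Emery_nH] using h

/-- **Non-vacuity witness**: the Hirayama2019 cGW-SIC MACE set (Δ 2.42, t_pd 1.257, t_pp 0.85, U_dd 8.84, U_pp 5.31, U_pd ≈ 2) with Weber2012 t_pp′ 0.161 at p = 1/8 — a non-vacuity witness. [folklore] -/
theorem emeryBoxHg1201_witness_mem :
    emeryBoxHg1201.Mem (fun c => match c with
      | .DeltaPd => (((121/50) : ℚ) : ℝ)
      | .tpd => (((1257/1000) : ℚ) : ℝ)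
      | .tpp => (((17/20) : ℚ) : ℝ)
      | .tppP => (((161/1000) : ℚ) : ℝ)
      | .Udd => (((221/25) : ℚ) : ℝ)
      | .Upp => (((531/100) : ℚ) : ℝ)
      | .Vpd => (((2) : ℚ) : ℝ)
      | .nHoles => (((9/8) : ℚ) : ℝ)
      ) := by
  rw [emeryBoxHg1201_mem_iff]
  refine ⟨?_, ?_, ?_, ?_, ?_, ?_, ?_, ?_, ?_, ?_, ?_, ?_, ?_, ?_, ?_, ?_⟩ <;> exact_mod_cast (by norm_num)

end Summit.Ventures.CertifiedManyBodySolver.Downfold
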